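import Literature.Geometry.Kaehler.ComplexTorusHodgeLieAlgebraRatProductGoursat
import Literature.Geometry.Kaehler.ComplexTorusHodgeGroupProductCenterQuotient
import Literature.Geometry.Kaehler.ComplexTorusEllipticCurveHodgeLieAlgebraRat
import HarnessLib

/-!
# Moonen–Zarhin's Lemma (3.6) and Proposition (3.8) OVER `ℚ`, WITH ENDOMORPHISM WITNESSES: over a factor `X₂` with solvable
# (e.g. abelian = CM) rational Hodge Lie algebra `𝒜(X₂)`, every `W ∈ 𝒜(X₂)` pairs in `𝒜(X₁ × X₂)` with a CENTRAL element of
# `𝒜(X₁)` — a rational ENDOMORPHISM `B ∈ 𝒜(X₁) ∩ End⁰(X₁) ⊆ Z(End⁰(X₁))`, Rosati-antisymmetric; non-splitting is witnessed by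
# such a `B ≠ 0`; and for `dim_ℚ 𝒜(X₂) = 1` (a CM elliptic curve) `𝒜(X₁ × X₂) ≅ 𝒜(X₁)` is the graph of `W ↦ B`

Layer `Literature/Geometry/Kaehler`, namespace `Literature.Geometry.Kaehler.ComplexTorus`; lane `lit-hodgefound` (Track 2
foundations library), Layer A3/A4; prover seat `lit-hodgefound-p17` (generation 42, self-proposed row g42-#2 = the gen-41 free
pointer 1 «MZ Prop. (3.8) proper, over `ℚ`» as far as Lie algebras reach), sequel of g42-#1 `ComplexTorusHodgeLieAlgebraRatProductGoursat`
(the Goursat position of `𝒜(X₁ × X₂)` over `ℚ`: `exists_lieHom_toBlocks_rat`, the one-sided splitting tests) and of the pure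
Lie-algebra lemma «`𝔷(𝔞) + 𝔫₁ = 𝔞`» of g41-#1 `GoursatPerfectSolvable` (`center_sup_map_ker_eq_top_of_hasCentralRadical_of_isSolvable`),
with p36's rational infrastructure `𝔷(𝒜) = 𝒜 ∩ End⁰(X)` (`mk_mem_center_hodgeGroupLieRat_iff_mem_endAlgRat`), `𝒜` reductive
for a polarised torus (`IsRiemannForm.hasCentralRadical_hodgeGroupLieRat`), `B' = -B` on `𝒜` (`IsRiemannForm.rosati_eq_neg_of_mem_hodgeGroupLieRat`)
and `dim_ℚ 𝒜(E) = 1` for a CM elliptic curve (`finrank_hodgeGroupLieRat_ellipticPeriod_of_ne_bot`).  Everything is consumed BY NAME.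
THEOREMS ONLY (no definition, no instance, no notation, no named fact; D-0026 net debt 0).

WHY THIS IS THE `ℚ`-CONTENT OF (3.6)/(3.8).  Moonen–Zarhin prove: if `Hg(X₂)` is a `ℚ`-simple torus and `Hg(X) ≠ Hg(X₁) × Hg(X₂)`
then «the center of `Hg(X₁)` contains an algebraic torus which is `ℚ`-isogenous to `Hg(X₂)`» ((3.6)), via «`𝔥𝔤(X) = 𝔤₁ ⊕ 𝔤₃ ≅
𝔥𝔤(X₁)` and `𝔥𝔤(X₂) ≅ 𝔤₃`»; and for a CM elliptic curve `E` (`Hg(E) = U_k`) they deduce an embedding of `k` into the centre of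
`End⁰(X₁)` ((3.8)), using that the centre `Z` of `Hg(X₁)` lies in `U_{F₁} × ⋯ × U_{F_n}` (the `Fᵢ` the CM centres of the simple
factors of `End⁰(X₁)`).  At the level of the RATIONAL Lie algebras this reads: the Goursat quotient `𝔤₃` is covered by the
centre `𝔷(𝒜(X₁))`, and `𝔷(𝒜(X₁)) = 𝒜(X₁) ∩ End⁰(X₁)` consists of central, Rosati-antisymmetric ENDOMORPHISMS of `X₁` (the Lie
algebra of `∏ U_{Fᵢ}`); so non-splitting produces a NON-ZERO `B ∈ Z(End⁰(X₁))` with `B' = -B` — `End⁰(X₁)` has a factor whose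
centre is not fixed by the Rosati involution («of type IV») —, and for `dim 𝒜(X₂) = 1` the whole of `𝒜(X₁ × X₂)` is the graph
`{(A + B(W), W)}` over `𝔤₁ ⊕ 𝒜(X₂)`.  The field embedding `k ↪ Fᵢ` itself needs the character groups of the tori `U_k`, `U_F`
(Ribet's lemma (3.7)) and is NOT a Lie-algebra statement; it is not claimed here.

## Sources, verbatim

* [MoonenZarhin1999LowDim] B. Moonen, Yu. G. Zarhin, *Hodge classes on abelian varieties of low dimension*, Math. Ann. 315
  (1999), §3 (held `paper:arxiv-math_9901113` p0007 L16–L28): «(3.6) Lemma. Let `X₁` and `X₂` be nonzero complex abelian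
  varieties. Assume that the Hodge group `Hg(X₂)` is a `ℚ`-simple algebraic torus. (In particular `X₂` is of CM-type.) Write
  `X = X₁ × X₂`. If `Hg(X) ≠ Hg(X₁) × Hg(X₂)` then the center of `Hg(X₁)` contains an algebraic torus which is `ℚ`-isogenous to
  `Hg(X₂)`. […] we then have that `𝔥𝔤(X) = 𝔤₁ ⊕ 𝔤₃ ≅ 𝔥𝔤(X₁)` and `𝔥𝔤(X₂) ≅ 𝔤₃`.»; p0007 L55–L72: «(3.8) Proposition. Let `X`
  be an abelian variety and let `E` be an elliptic curve, both over `ℂ`. Suppose `Hom(E,X) = 0`. Then either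
  `Hg(X × E) = Hg(X) × Hg(E)` or `End⁰(E) = k` is an imaginary quadratic field such that there exists an embedding of `k` into
  the center of `End⁰(X)`. […] Write `C` for the center of `End⁰(X)`. Then `C` has the form `C = K₁ × ⋯ × K_m × F₁ × ⋯ × F_n`,
  where `K₁, …, K_m` are totally real fields and `F₁, ⋯, F_n` are CM-fields. The center `Z` of `Hg(X)` is contained in
  `U_{F₁} × ⋯ × U_{F_n}`.»
* [Gordon1997] B. B. Gordon, *A survey of the Hodge conjecture for abelian varieties* (alg-geom/9709030), §2.16 Proposition
  (Goursat's Lemma; held p0012 L112–L125), §2.12 (reductivity of `𝔥𝔤`).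
* [GreenGriffithsKerr2012] M. Green, P. Griffiths, M. Kerr, *Mumford–Tate Groups and Domains* (2012), §II.C, Lemma after
  (II.C.1) («`𝒜 ⊂ 𝔤` … defined over `ℚ`») and §III.B (i).
* [Lange2023AbelianVarietiesComplex] H. Lange, *Abelian Varieties over the Complex Numbers* (2023), §7.2.2 Prop. 7.2.5
  («`End_ℚ(X) ≃ End(V)^{Hg(X)}`»), §7.2.1 Prop. 7.2.3 (`Hg(X) ⊆ Sp(V, E)`; infinitesimally `A' = -A` on `𝔥𝔤`), §7.2.3
  Prop. 7.2.6 (CM type ⟺ `Hg(X)` commutative).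
* [Bourbaki1989LieGroups13] N. Bourbaki, *Lie Groups and Lie Algebras, Chapters 1–3*, Ch. I §6 no. 4 Prop. 5 and Cor.
  (reductive algebras: `𝔞 = 𝔷(𝔞) ⊕ 𝒟𝔞`, solvable quotients are abelian).
* [Hazama1983] F. Hazama, Tôhoku Math. J. 35 (1983), Lemma (3.1).

## What is proved

* §1 (any tori; `X₁` POLARISED, `𝒜(X₂)` SOLVABLE — e.g. abelian, i.e. `X₂` of CM type):
  **`IsRiemannForm.exists_mem_endAlgRat_fromBlocks_mem_hodgeGroupLieRat_prod_of_isSolvable`** (★ for every `W ∈ 𝒜(X₂)` there is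
  `B ∈ 𝒜(X₁) ∩ End⁰(X₁)` with `(B 0; 0 W) ∈ 𝒜(X₁ × X₂)`), `IsRiemannForm.exists_mem_center_endAlgRat_fromBlocks_mem_of_isSolvable`
  (the same `B` is central in `End⁰(X₁)` and Rosati-antisymmetric for every polarisation with rational Gram matrix),
  `IsRiemannForm.finrank_add_le_finrank_prod_add_finrank_center_of_isSolvable` (MZ (3.6) as the inequality
  `dim_ℚ 𝒜(X₁) + dim_ℚ 𝒜(X₂) ≤ dim_ℚ 𝒜(X₁ × X₂) + dim_ℚ 𝔷(𝒜(X₁))` over `ℚ`),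
  **`IsRiemannForm.exists_ne_zero_mem_endAlgRat_of_ne_of_isSolvable`** (NON-SPLIT ⟹ a NON-ZERO central Rosati-antisymmetric
  endomorphism `B ∈ 𝒜(X₁) ∩ Z(End⁰(X₁))` and a `W ∈ 𝒜(X₂)` with `(0 0; 0 W) ∉ 𝒜(X)`, `(B 0; 0 W) ∈ 𝒜(X)`),
  `IsRiemannForm.hodgeGroupC_prod_eq_blockDiagProd_of_forall_mem_endAlgRat_eq_zero_of_isSolvable` (`𝒜(X₁) ∩ End⁰(X₁) = 0 ⟹` the
  groups split), `IsRiemannForm.hodgeGroupC_prod_eq_blockDiagProd_of_isSemisimple_hodgeGroupLieRat_of_isSolvable` (`𝒜(X₁)` semisimple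
  over `ℚ` ⟹ split), `IsRiemannForm.not_isSemisimple_hodgeGroupLieRat_of_ne_of_isSolvable`; the variants of ★ for `𝒜(X₂)` abelian
  (`…_of_isLieAbelian`), `X₂` polarised of CM type (`…_of_exists_comm_isReduced_le_endAlgRat`) and `Hg(X₂)(ℝ)` commutative
  (`…_of_hodgeGroup_comm`).
* §2 (`dim_ℚ 𝒜(X₂) = 1`, e.g. `X₂` a CM elliptic curve; `isLieAbelian_hodgeGroupLieRat_of_finrank_eq_one`):
  `eq_zero_of_zero_fromBlocks_mem_of_ne_of_finrank_eq_one` (non-split ⟹ `𝔤₂(ℚ) = 0`: `(0 0; 0 W) ∈ 𝒜(X) ⟹ W = 0`, no polarisation),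
  **`nonempty_lieEquiv_hodgeGroupLieRat_prod_of_ne_of_finrank_eq_one`** (non-split ⟹ `r₁ : 𝒜(X₁ × X₂) ≅ 𝒜(X₁)` over `ℚ` —
  MZ «`𝔥𝔤(X) = 𝔤₁ ⊕ 𝔤₃ ≅ 𝔥𝔤(X₁)`»), `finrank_hodgeGroupLieRat_prod_eq_of_ne_of_finrank_eq_one`,
  **`IsRiemannForm.exists_ne_zero_mem_center_endAlgRat_fromBlocks_mem_of_ne_of_finrank_eq_one`** (THE GRAPH: non-split ⟹ every
  `W ≠ 0` in `𝒜(X₂)` pairs with a non-zero central Rosati-antisymmetric endomorphism `B` of `X₁`, `(B 0; 0 W) ∈ 𝒜(X)`, unique modulo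
  `𝔤₁(ℚ)`), **`IsRiemannForm.hodgeGroupC_prod_eq_blockDiagProd_or_exists_of_finrank_eq_one`** (MZ (3.8) AS A DICHOTOMY, rational
  infinitesimal form), `finrank_hodgeGroupLieRat_prod_eq_iff_ne_of_finrank_eq_one`,
  `IsRiemannForm.hodgeGroupC_prod_eq_blockDiagProd_of_forall_mem_endAlgRat_eq_zero_of_finrank_eq_one`.
* §3 the CM-ELLIPTIC-CURVE instance (`X₂ = E_τ` with `End(E_τ) ≠ ℤ`, p36's `finrank_hodgeGroupLieRat_ellipticPeriod_of_ne_bot`):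
  **`IsRiemannForm.hodgeGroupC_prod_ellipticPeriod_eq_blockDiagProd_or_exists`** (MZ (3.8) for `X₁ × E_τ`),
  `IsRiemannForm.hodgeGroupC_prod_ellipticPeriod_eq_blockDiagProd_of_forall_mem_endAlgRat_eq_zero`.

NOT here: the embedding `k ↪ Z(End⁰(X₁))` of (3.8) (tori `U_k`, `U_F` and their characters; Ribet's Lemma (3.7)); `ℚ`-simplicity of
`Hg(X₂)` beyond `dim = 1`; the hypothesis `Hom(E, X₁) = 0` plays no rôle at the Lie-algebra level (it enters (3.8) only through the
field embedding).
-/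

noncomputable section

open Matrix Module Function

namespace Literature.Geometry.Kaehler

namespace ComplexTorus

open Literature.NumberTheory.Automorphic (IsAlgebraicSubgroup IsZConnected identityComponent isZConnected_identityComponent
  lieAlgebraGL lieSubalgebraGL)
open Literature.Algebra.Lie

/-! ### §0 Plumbing (file-local) -/

section Plumbing

variable {m m' R : Type*} [Ring R]

/-- Difference of block-diagonal matrices. [folklore] -/
private theorem fromBlocks_diag_sub_fromBlocks_diag (A A' : Matrix m m R) (B B' : Matrix m' m' R) :
    fromBlocks A 0 0 B - fromBlocks A' 0 0 B' = fromBlocks (A - A') 0 0 (B - B') := by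
  simp only [sub_eq_add_neg, fromBlocks_neg, fromBlocks_add, neg_zero, add_zero]

/-- A Lie algebra of dimension `1` over a field is abelian (`⁅a v, b v⁆ = ab ⁅v, v⁆ = 0`). [folklore] -/
private theorem isLieAbelian_of_finrank_eq_one {K L : Type*} [Field K] [LieRing L] [LieAlgebra K L]
    (h : Module.finrank K L = 1) : IsLieAbelian L := by
  haveI : Module.Finite K L := Module.finite_of_finrank_eq_succ h
  obtain ⟨v, -, hv⟩ := finrank_eq_one_iff'.1 h
  refine ⟨fun x y ↦ ?_⟩
  obtain ⟨a, rfl⟩ := hv x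
  obtain ⟨b, rfl⟩ := hv y
  rw [smul_lie, lie_smul, lie_self, smul_zero, smul_zero]

/-- A Lie subalgebra of `𝔤𝔩_ι(R)` (commutator bracket) whose elements commute as matrices is abelian. [folklore] -/
private theorem isLieAbelian_of_forall_mul_comm {ι : Type*} [Fintype ι] [DecidableEq ι] {R : Type*} [CommRing R]
    (K : @LieSubalgebra R (Matrix ι ι R) _ LieRing.ofAssociativeRing LieAlgebra.ofAssociativeAlgebra)
    (h : ∀ X ∈ K, ∀ Y ∈ K, X * Y = Y * X) : IsLieAbelian K := by
  letI : LieRing (Matrix ι ι R) := LieRing.ofAssociativeRing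
  letI : LieAlgebra R (Matrix ι ι R) := LieAlgebra.ofAssociativeAlgebra
  exact ⟨fun X Y ↦ Subtype.ext (by
    rw [LieSubalgebra.coe_bracket, Ring.lie_def, ZeroMemClass.coe_zero, h X.1 X.2 Y.1 Y.2, sub_self])⟩

end Plumbing

/-! ### §1 A solvable factor: every `W ∈ 𝒜(X₂)` pairs with a central endomorphism of `X₁` -/

section Solvable

variable {ι₁ ι₂ : Type*} [Fintype ι₁] [Fintype ι₂] [DecidableEq ι₁] [DecidableEq ι₂]
  {E₁ E₂ : Type*} [NormedAddCommGroup E₁] [NormedSpace ℂ E₁] [NormedAddCommGroup E₂] [NormedSpace ℂ E₂]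
  {Φ₁ : (ι₁ → ℝ) ≃L[ℝ] E₁} (Φ₂ : (ι₂ → ℝ) ≃L[ℝ] E₂) {η₁ : E₁ [⋀^Fin 2]→L[ℝ] ℝ}

/-- **★ OVER A SOLVABLE FACTOR EVERY `W ∈ 𝒜(X₂)` PAIRS WITH A CENTRAL ELEMENT OF `𝒜(X₁)`, WHICH IS AN ENDOMORPHISM OF `X₁`.**
For `X₁` polarised (`𝒜(X₁)` reductive) and `𝒜(X₂)` solvable: for every `W ∈ 𝒜(X₂)` there is `B ∈ 𝒜(X₁) ∩ End⁰(X₁)` (`= 𝔷(𝒜(X₁))`)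
with `(B 0; 0 W) ∈ 𝒜(X₁ × X₂)`.  Proof: lift `W = C₂₂`, `C ∈ 𝒜(X)` (the second block projection is onto, g42-#1); write
`C₁₁ = z + n` with `z ∈ 𝔷(𝒜(X₁))`, `n ∈ 𝔤₁ = r₁(ker r₂)` («`𝔷(𝔞) + 𝔫₁ = 𝔞`» for reductive `𝔞`, solvable `𝔟`); subtract the lift
`(n 0; 0 0) ∈ 𝒜(X)` of `n`. [cite: MoonenZarhin1999LowDim, §3 Lemma (3.6) (p0007 L16–L28)] [cite: Gordon1997, §2.16 Proposition and §2.12]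
[cite: Bourbaki1989LieGroups13, Ch. I §6 no. 4 Prop. 5 and Cor.] [cite: Lange2023AbelianVarietiesComplex, §7.2.2 Prop. 7.2.5] -/
theorem IsRiemannForm.exists_mem_endAlgRat_fromBlocks_mem_hodgeGroupLieRat_prod_of_isSolvable (hη₁ : IsRiemannForm Φ₁ η₁)
    [LieAlgebra.IsSolvable (hodgeGroupLieRat Φ₂)] {W : Matrix ι₂ ι₂ ℚ} (hW : W ∈ hodgeGroupLieRat Φ₂) :
    ∃ B ∈ hodgeGroupLieRat Φ₁, B ∈ endAlgRat Φ₁ ∧ fromBlocks B 0 0 W ∈ hodgeGroupLieRat (prodPeriod Φ₁ Φ₂) := by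
  letI : LieRing (Matrix (ι₁ ⊕ ι₂) (ι₁ ⊕ ι₂) ℚ) := LieRing.ofAssociativeRing
  letI : LieAlgebra ℚ (Matrix (ι₁ ⊕ ι₂) (ι₁ ⊕ ι₂) ℚ) := LieAlgebra.ofAssociativeAlgebra
  letI : LieRing (Matrix ι₁ ι₁ ℚ) := LieRing.ofAssociativeRing
  letI : LieAlgebra ℚ (Matrix ι₁ ι₁ ℚ) := LieAlgebra.ofAssociativeAlgebra
  obtain ⟨f, g, hf, hg, hfs, hgs, -⟩ := exists_lieHom_toBlocks_rat Φ₁ Φ₂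
  haveI := finite_hodgeGroupLieRat Φ₁
  haveI := hη₁.hasCentralRadical_hodgeGroupLieRat
  -- lift `W`
  obtain ⟨C, hC⟩ := hgs ⟨W, hW⟩
  have hC₂₂ : (C : Matrix (ι₁ ⊕ ι₂) (ι₁ ⊕ ι₂) ℚ).toBlocks₂₂ = W := by rw [← hg C, hC]
  -- `C₁₁ = z + n`, `z` central, `n ∈ 𝔤₁`
  have htop := GoursatPerfectSolvable.center_sup_map_ker_eq_top_of_hasCentralRadical_of_isSolvable f g hfs
  have hfC : f C ∈ LieAlgebra.center ℚ (hodgeGroupLieRat Φ₁) ⊔ LieIdeal.map f g.ker := by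
    rw [htop]; exact LieSubmodule.mem_top _
  obtain ⟨z, hz, n, hn, hzn⟩ := (LieSubmodule.mem_sup _ _ _).1 hfC
  -- lift `n` to `D ∈ 𝒜(X)` with `D₂₂ = 0`, `D₁₁ = n`
  obtain ⟨D, hgD, hfD⟩ := (GoursatLemma.mem_map_ker_iff f g hfs).1 hn
  have hD₂₂ : (D : Matrix (ι₁ ⊕ ι₂) (ι₁ ⊕ ι₂) ℚ).toBlocks₂₂ = 0 := by rw [← hg D, hgD]; rfl
  have hD₁₁ : (D : Matrix (ι₁ ⊕ ι₂) (ι₁ ⊕ ι₂) ℚ).toBlocks₁₁ = n := by rw [← hf D, hfD]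
  have hC₁₁ : (C : Matrix (ι₁ ⊕ ι₂) (ι₁ ⊕ ι₂) ℚ).toBlocks₁₁ = (z : Matrix ι₁ ι₁ ℚ) + n := by
    rw [← hf C, ← hzn]; rfl
  -- `C - D = (z 0; 0 W)`
  have hmem : ((C : Matrix (ι₁ ⊕ ι₂) (ι₁ ⊕ ι₂) ℚ) - D) ∈ hodgeGroupLieRat (prodPeriod Φ₁ Φ₂) := sub_mem C.2 D.2
  have heq : (C : Matrix (ι₁ ⊕ ι₂) (ι₁ ⊕ ι₂) ℚ) - D = fromBlocks (z : Matrix ι₁ ι₁ ℚ) 0 0 W := by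
    rw [eq_fromBlocks_of_mem_hodgeGroupLieRat_prod Φ₁ Φ₂ C.2, eq_fromBlocks_of_mem_hodgeGroupLieRat_prod Φ₁ Φ₂ D.2, hC₁₁, hC₂₂,
      hD₁₁, hD₂₂, fromBlocks_diag_sub_fromBlocks_diag, add_sub_cancel_right, sub_zero]
  refine ⟨z, z.2, (mk_mem_center_hodgeGroupLieRat_iff_mem_endAlgRat z.2).1 (by simpa using hz), ?_⟩
  rw [← heq]
  exact hmem

/-- **★ with the qualities of `B` spelled out: `B ∈ Z(End⁰(X₁))` and `B' = -B` for every polarisation with rational Gram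
matrix `G₀`** (`𝒜 ⊆ C(End⁰(X))`, Lange 7.2.5; `A' = -A` on `𝒜`, Lange 7.2.3 infinitesimally) — the Lie algebra of Moonen–Zarhin's
«the center `Z` of `Hg(X)` is contained in `U_{F₁} × ⋯ × U_{F_n}`». [cite: MoonenZarhin1999LowDim, §3 Lemma (3.6) and Prop. (3.8), proof (p0007 L64–L67)]
[cite: Lange2023AbelianVarietiesComplex, §7.2.2 Prop. 7.2.5 and §7.2.1 Prop. 7.2.3] -/
theorem IsRiemannForm.exists_mem_center_endAlgRat_fromBlocks_mem_of_isSolvable (hη₁ : IsRiemannForm Φ₁ η₁)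
    [LieAlgebra.IsSolvable (hodgeGroupLieRat Φ₂)] {W : Matrix ι₂ ι₂ ℚ} (hW : W ∈ hodgeGroupLieRat Φ₂) :
    ∃ B ∈ hodgeGroupLieRat Φ₁, B ∈ endAlgRat Φ₁ ∧ (∀ C ∈ endAlgRat Φ₁, B * C = C * B) ∧
      (∀ G₀ : Matrix ι₁ ι₁ ℚ, G₀.map ((↑) : ℚ → ℝ) = latticeGram Φ₁ η₁ → rosati G₀ B = -B) ∧
      fromBlocks B 0 0 W ∈ hodgeGroupLieRat (prodPeriod Φ₁ Φ₂) := by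
  obtain ⟨B, hB, hBE, hmem⟩ := hη₁.exists_mem_endAlgRat_fromBlocks_mem_hodgeGroupLieRat_prod_of_isSolvable Φ₂ hW
  refine ⟨B, hB, hBE, fun C hC ↦ ?_, fun G₀ hG₀ ↦ hη₁.rosati_eq_neg_of_mem_hodgeGroupLieRat hG₀ hB, hmem⟩
  exact ((Subalgebra.mem_centralizer_iff ℚ).1 (coe_hodgeGroupLieRat_subset_centralizer_endAlgRat Φ₁ hB) C hC).symm

/-- The same for a factor `X₂` with ABELIAN `𝒜(X₂)` (`Hg(X₂)` commutative, Lange 7.2.6: `X₂` of CM type).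
[cite: MoonenZarhin1999LowDim, §3 Lemma (3.6)] [cite: Lange2023AbelianVarietiesComplex, §7.2.3 Prop. 7.2.6] -/
theorem IsRiemannForm.exists_mem_center_endAlgRat_fromBlocks_mem_of_isLieAbelian (hη₁ : IsRiemannForm Φ₁ η₁)
    [IsLieAbelian (hodgeGroupLieRat Φ₂)] {W : Matrix ι₂ ι₂ ℚ} (hW : W ∈ hodgeGroupLieRat Φ₂) :
    ∃ B ∈ hodgeGroupLieRat Φ₁, B ∈ endAlgRat Φ₁ ∧ (∀ C ∈ endAlgRat Φ₁, B * C = C * B) ∧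
      (∀ G₀ : Matrix ι₁ ι₁ ℚ, G₀.map ((↑) : ℚ → ℝ) = latticeGram Φ₁ η₁ → rosati G₀ B = -B) ∧
      fromBlocks B 0 0 W ∈ hodgeGroupLieRat (prodPeriod Φ₁ Φ₂) :=
  hη₁.exists_mem_center_endAlgRat_fromBlocks_mem_of_isSolvable Φ₂ hW

/-- The same for `X₂` POLARISED OF CM TYPE (a commutative reduced `T ⊆ End⁰(X₂)` of rank `2 dim X₂`: then `𝒜(X₂)` is abelian,
p36's `IsRiemannForm.isLieAbelian_hodgeGroupLieRat_iff_exists_comm_isReduced_le_endAlgRat`). [cite: MoonenZarhin1999LowDim, §3 Lemma (3.6) ("In particular `X₂` is of CM-type")]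
[cite: Lange2023AbelianVarietiesComplex, §7.2.3 Prop. 7.2.6] -/
theorem IsRiemannForm.exists_mem_center_endAlgRat_fromBlocks_mem_of_exists_comm_isReduced_le_endAlgRat
    (hη₁ : IsRiemannForm Φ₁ η₁) {η₂ : E₂ [⋀^Fin 2]→L[ℝ] ℝ} (hη₂ : IsRiemannForm Φ₂ η₂)
    (hCM : ∃ T : Subalgebra ℚ (Matrix ι₂ ι₂ ℚ), T ≤ endAlgRat Φ₂ ∧ IsReduced T ∧ (∀ a ∈ T, ∀ b ∈ T, a * b = b * a) ∧
      finrank ℚ T = Fintype.card ι₂) {W : Matrix ι₂ ι₂ ℚ} (hW : W ∈ hodgeGroupLieRat Φ₂) :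
    ∃ B ∈ hodgeGroupLieRat Φ₁, B ∈ endAlgRat Φ₁ ∧ (∀ C ∈ endAlgRat Φ₁, B * C = C * B) ∧
      (∀ G₀ : Matrix ι₁ ι₁ ℚ, G₀.map ((↑) : ℚ → ℝ) = latticeGram Φ₁ η₁ → rosati G₀ B = -B) ∧
      fromBlocks B 0 0 W ∈ hodgeGroupLieRat (prodPeriod Φ₁ Φ₂) := by
  haveI : IsLieAbelian (hodgeGroupLieRat Φ₂) :=
    (hη₂.isLieAbelian_hodgeGroupLieRat_iff_exists_comm_isReduced_le_endAlgRat).2 hCM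
  exact hη₁.exists_mem_center_endAlgRat_fromBlocks_mem_of_isSolvable Φ₂ hW

/-- The same for `X₂` POLARISED WITH COMMUTATIVE HODGE GROUP `Hg(X₂)(ℝ)`. [cite: MoonenZarhin1999LowDim, §3 Lemma (3.6)]
[cite: Lange2023AbelianVarietiesComplex, §7.2.3 Prop. 7.2.6 (i)] -/
theorem IsRiemannForm.exists_mem_center_endAlgRat_fromBlocks_mem_of_hodgeGroup_comm
    (hη₁ : IsRiemannForm Φ₁ η₁) {η₂ : E₂ [⋀^Fin 2]→L[ℝ] ℝ} (hη₂ : IsRiemannForm Φ₂ η₂)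
    (hcomm : ∀ M ∈ hodgeGroup Φ₂, ∀ N ∈ hodgeGroup Φ₂, M * N = N * M) {W : Matrix ι₂ ι₂ ℚ} (hW : W ∈ hodgeGroupLieRat Φ₂) :
    ∃ B ∈ hodgeGroupLieRat Φ₁, B ∈ endAlgRat Φ₁ ∧ (∀ C ∈ endAlgRat Φ₁, B * C = C * B) ∧
      (∀ G₀ : Matrix ι₁ ι₁ ℚ, G₀.map ((↑) : ℚ → ℝ) = latticeGram Φ₁ η₁ → rosati G₀ B = -B) ∧
      fromBlocks B 0 0 W ∈ hodgeGroupLieRat (prodPeriod Φ₁ Φ₂) := by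
  haveI : IsLieAbelian (hodgeGroupLieRat Φ₂) :=
    isLieAbelian_of_forall_mul_comm _ ((hη₂.hodgeGroupLieRat_comm_iff_hodgeGroup_comm).2 hcomm)
  exact hη₁.exists_mem_center_endAlgRat_fromBlocks_mem_of_isSolvable Φ₂ hW

/-- **MOONEN–ZARHIN'S LEMMA (3.6) AS AN INEQUALITY OVER `ℚ`**: `dim_ℚ 𝒜(X₁) + dim_ℚ 𝒜(X₂) ≤ dim_ℚ 𝒜(X₁ × X₂) + dim_ℚ 𝔷(𝒜(X₁))`
(`X₁` polarised, `𝒜(X₂)` solvable): the Goursat quotient `𝔤₃ = 𝒜(X₂) ⧸ 𝔤₂` is covered by the centre of `𝒜(X₁)` — «the center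
of `Hg(X₁)` contains an algebraic torus which is `ℚ`-isogenous to» `Hg(X₂) ⧸ K₂`, in dimensions.  (`𝔷(𝒜(X₁)) = 𝒜(X₁) ∩ End⁰(X₁)`,
p36's `coe_center_hodgeGroupLieRat_eq`; the `ℂ`-form is g41-#2's `zdim_add_zdim_le_zdim_prod_add_finrank_center_of_isSolvable`.)
[cite: MoonenZarhin1999LowDim, §3 Lemma (3.6)] [cite: Hazama1983, Lemma (3.1)] [cite: Bourbaki1989LieGroups13, Ch. I §6 no. 4 Prop. 5 and Cor.] -/
theorem IsRiemannForm.finrank_add_le_finrank_prod_add_finrank_center_of_isSolvable (hη₁ : IsRiemannForm Φ₁ η₁)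
    [LieAlgebra.IsSolvable (hodgeGroupLieRat Φ₂)] :
    finrank ℚ (hodgeGroupLieRat Φ₁) + finrank ℚ (hodgeGroupLieRat Φ₂) ≤
      finrank ℚ (hodgeGroupLieRat (prodPeriod Φ₁ Φ₂)) + finrank ℚ (LieAlgebra.center ℚ (hodgeGroupLieRat Φ₁)) := by
  obtain ⟨f, g, -, -, hfs, hgs, hker⟩ := exists_lieHom_toBlocks_rat Φ₁ Φ₂
  haveI := finite_hodgeGroupLieRat (prodPeriod Φ₁ Φ₂)
  haveI := finite_hodgeGroupLieRat Φ₁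
  haveI := finite_hodgeGroupLieRat Φ₂
  haveI := hη₁.hasCentralRadical_hodgeGroupLieRat
  have h₁ := GoursatLemma.finrank_add_finrank_quotient_eq f g hfs hgs hker
  have h₂ := GoursatLemma.finrank_quotient_map_ker_eq f g hfs hgs
  have h₃ := GoursatCenter.finrank_quotient_map_ker_le_finrank_center' f g hfs hgs
  omega

/-- **NON-SPLITTING IS WITNESSED BY A NON-ZERO CENTRAL ENDOMORPHISM OF `X₁` IN `𝒜(X₁)`** (`X₁` polarised, `𝒜(X₂)` solvable):
if `Hg(X₁ × X₂)(ℂ) ≠ Hg(X₁)(ℂ) × Hg(X₂)(ℂ)` there are `W ∈ 𝒜(X₂)` with `(0 0; 0 W) ∉ 𝒜(X₁ × X₂)` and a NON-ZERO `B ∈ 𝒜(X₁) ∩ Z(End⁰(X₁))`,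
Rosati-antisymmetric for every polarisation, with `(B 0; 0 W) ∈ 𝒜(X₁ × X₂)` — the rational, infinitesimal form of «the center of
`Hg(X₁)` contains an algebraic torus» ≠ 1, sitting in `∏ U_{Fᵢ}`: `End⁰(X₁)` has a factor with centre not fixed by `'`.
[cite: MoonenZarhin1999LowDim, §3 Lemma (3.6) and Prop. (3.8), proof] [cite: Lange2023AbelianVarietiesComplex, §7.2.2 Prop. 7.2.5 and §7.2.1 Prop. 7.2.3] -/
theorem IsRiemannForm.exists_ne_zero_mem_endAlgRat_of_ne_of_isSolvable (hη₁ : IsRiemannForm Φ₁ η₁)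
    [LieAlgebra.IsSolvable (hodgeGroupLieRat Φ₂)]
    (hne : hodgeGroupC (prodPeriod Φ₁ Φ₂) ≠ blockDiagProd (hodgeGroupC Φ₁) (hodgeGroupC Φ₂)) :
    ∃ B ∈ hodgeGroupLieRat Φ₁, B ∈ endAlgRat Φ₁ ∧ B ≠ 0 ∧ (∀ C ∈ endAlgRat Φ₁, B * C = C * B) ∧
      (∀ G₀ : Matrix ι₁ ι₁ ℚ, G₀.map ((↑) : ℚ → ℝ) = latticeGram Φ₁ η₁ → rosati G₀ B = -B) ∧
      ∃ W ∈ hodgeGroupLieRat Φ₂, fromBlocks (0 : Matrix ι₁ ι₁ ℚ) 0 0 W ∉ hodgeGroupLieRat (prodPeriod Φ₁ Φ₂) ∧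
        fromBlocks B 0 0 W ∈ hodgeGroupLieRat (prodPeriod Φ₁ Φ₂) := by
  obtain ⟨W, hW, hWnot⟩ : ∃ W ∈ hodgeGroupLieRat Φ₂,
      fromBlocks (0 : Matrix ι₁ ι₁ ℚ) 0 0 W ∉ hodgeGroupLieRat (prodPeriod Φ₁ Φ₂) := by
    by_contra h
    refine hne ((hodgeGroupC_prod_eq_blockDiagProd_iff_forall_zero_fromBlocks_mem Φ₁ Φ₂).2 fun W hW ↦ ?_)
    by_contra hW'
    exact h ⟨W, hW, hW'⟩
  obtain ⟨B, hB, hBE, hcomm, hros, hmem⟩ := hη₁.exists_mem_center_endAlgRat_fromBlocks_mem_of_isSolvable Φ₂ hW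
  refine ⟨B, hB, hBE, ?_, hcomm, hros, W, hW, hWnot, hmem⟩
  rintro rfl
  exact hWnot hmem

/-- **`𝒜(X₁) ∩ End⁰(X₁) = 0 ⟹ Hg(X₁ × X₂) = Hg(X₁) × Hg(X₂)`** for `X₁` polarised and `𝒜(X₂)` solvable (e.g. `X₂` of CM type):
the `ℚ`-form of «`𝔥𝔤(X₁)` semisimple and `X₂` CM ⟹ the Hodge group of the product splits» (MZ (3.2)(2) ∕ Gordon's lemma; the
`ℂ`-centre form is g41-#2's `IsRiemannForm.hodgeGroupC_prod_eq_blockDiagProd_of_center_eq_bot_of_isSolvable`).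
[cite: MoonenZarhin1999LowDim, §3 Lemma (3.6) and Prop. (3.8)] [cite: Gordon1997, §2.16 Proposition] -/
theorem IsRiemannForm.hodgeGroupC_prod_eq_blockDiagProd_of_forall_mem_endAlgRat_eq_zero_of_isSolvable
    (hη₁ : IsRiemannForm Φ₁ η₁) [LieAlgebra.IsSolvable (hodgeGroupLieRat Φ₂)]
    (h0 : ∀ B ∈ hodgeGroupLieRat Φ₁, B ∈ endAlgRat Φ₁ → B = 0) :
    hodgeGroupC (prodPeriod Φ₁ Φ₂) = blockDiagProd (hodgeGroupC Φ₁) (hodgeGroupC Φ₂) := by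
  by_contra hne
  obtain ⟨B, hB, hBE, hB0, -⟩ := hη₁.exists_ne_zero_mem_endAlgRat_of_ne_of_isSolvable Φ₂ hne
  exact hB0 (h0 B hB hBE)

/-- **`𝒜(X₁)` SEMISIMPLE OVER `ℚ` and `𝒜(X₂)` SOLVABLE ⟹ `Hg(X₁ × X₂) = Hg(X₁) × Hg(X₂)`** (`X₁` polarised).
[cite: MoonenZarhin1999LowDim, §3 Thm. (3.2)(2) and Lemma (3.6)] [cite: Gordon1997, §2.16 Proposition] -/
theorem IsRiemannForm.hodgeGroupC_prod_eq_blockDiagProd_of_isSemisimple_hodgeGroupLieRat_of_isSolvable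
    (hη₁ : IsRiemannForm Φ₁ η₁) [LieAlgebra.IsSemisimple ℚ (hodgeGroupLieRat Φ₁)] [LieAlgebra.IsSolvable (hodgeGroupLieRat Φ₂)] :
    hodgeGroupC (prodPeriod Φ₁ Φ₂) = blockDiagProd (hodgeGroupC Φ₁) (hodgeGroupC Φ₂) :=
  hη₁.hodgeGroupC_prod_eq_blockDiagProd_of_forall_mem_endAlgRat_eq_zero_of_isSolvable Φ₂
    (hη₁.isSemisimple_hodgeGroupLieRat_iff_forall_mem_endAlgRat_eq_zero.1 ‹_›)

/-- Non-splitting over a solvable factor forces `𝒜(X₁)` to be NON-semisimple over `ℚ` (`𝔷(𝒜(X₁)) ≠ 0`).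
[cite: MoonenZarhin1999LowDim, §3 Lemma (3.6)] -/
theorem IsRiemannForm.not_isSemisimple_hodgeGroupLieRat_of_ne_of_isSolvable (hη₁ : IsRiemannForm Φ₁ η₁)
    [LieAlgebra.IsSolvable (hodgeGroupLieRat Φ₂)]
    (hne : hodgeGroupC (prodPeriod Φ₁ Φ₂) ≠ blockDiagProd (hodgeGroupC Φ₁) (hodgeGroupC Φ₂)) :
    ¬ LieAlgebra.IsSemisimple ℚ (hodgeGroupLieRat Φ₁) := by
  intro h
  exact hne (hη₁.hodgeGroupC_prod_eq_blockDiagProd_of_isSemisimple_hodgeGroupLieRat_of_isSolvable Φ₂)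

end Solvable

/-! ### §2 A factor with one-dimensional Hodge Lie algebra (a CM elliptic curve): `𝔤₂(ℚ) = 0` and the graph `W ↦ B` -/

section OneDimensional

variable {ι₁ ι₂ : Type*} [Fintype ι₁] [Fintype ι₂] [DecidableEq ι₁] [DecidableEq ι₂]
  {E₁ E₂ : Type*} [NormedAddCommGroup E₁] [NormedSpace ℂ E₁] [NormedAddCommGroup E₂] [NormedSpace ℂ E₂]
  (Φ₁ : (ι₁ → ℝ) ≃L[ℝ] E₁) (Φ₂ : (ι₂ → ℝ) ≃L[ℝ] E₂)

/-- `dim_ℚ 𝒜(X₂) = 1 ⟹ 𝒜(X₂)` is abelian (so `X₂` is «of CM type» infinitesimally; e.g. a CM elliptic curve). [folklore]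
[cite: MoonenZarhin1999LowDim, §1 ("The Hodge group `Hg(X)` is a torus if and only if `X` is of CM-type")] -/
theorem isLieAbelian_hodgeGroupLieRat_of_finrank_eq_one (h1 : finrank ℚ (hodgeGroupLieRat Φ₂) = 1) :
    IsLieAbelian (hodgeGroupLieRat Φ₂) :=
  isLieAbelian_of_finrank_eq_one h1

/-- **NON-SPLIT WITH `dim_ℚ 𝒜(X₂) = 1 ⟹ 𝔤₂(ℚ) = 0`**: if `Hg(X₁ × X₂)(ℂ) ≠ Hg(X₁)(ℂ) × Hg(X₂)(ℂ)` then `(0 0; 0 W) ∈ 𝒜(X₁ × X₂)`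
only for `W = 0` (a non-zero such `W` would span `𝒜(X₂)`, and the one-sided test of g42-#1 would split the product).  No
polarisation needed.  MZ: «`𝔥𝔤(X₂)` does not contain a proper algebraic Lie subalgebra … `𝔥𝔤(X) = 𝔤₁ ⊕ 𝔤₃`» (`𝔤₂ = 0`).
[cite: MoonenZarhin1999LowDim, §3 Lemma (3.6), proof (p0007 L22–L28)] [cite: Hazama1983, Lemma (3.1)] -/
theorem eq_zero_of_zero_fromBlocks_mem_of_ne_of_finrank_eq_one (h1 : finrank ℚ (hodgeGroupLieRat Φ₂) = 1)
    (hne : hodgeGroupC (prodPeriod Φ₁ Φ₂) ≠ blockDiagProd (hodgeGroupC Φ₁) (hodgeGroupC Φ₂)) {W : Matrix ι₂ ι₂ ℚ}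
    (hW : fromBlocks (0 : Matrix ι₁ ι₁ ℚ) 0 0 W ∈ hodgeGroupLieRat (prodPeriod Φ₁ Φ₂)) : W = 0 := by
  letI : LieRing (Matrix (ι₁ ⊕ ι₂) (ι₁ ⊕ ι₂) ℚ) := LieRing.ofAssociativeRing
  letI : LieAlgebra ℚ (Matrix (ι₁ ⊕ ι₂) (ι₁ ⊕ ι₂) ℚ) := LieAlgebra.ofAssociativeAlgebra
  by_contra hW0
  apply hne
  rw [hodgeGroupC_prod_eq_blockDiagProd_iff_forall_zero_fromBlocks_mem]
  intro B hB
  have hW₂ : W ∈ hodgeGroupLieRat Φ₂ := by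
    have h := toBlocks₂₂_mem_hodgeGroupLieRat Φ₁ Φ₂ hW
    rwa [toBlocks_fromBlocks₂₂] at h
  haveI := finite_hodgeGroupLieRat Φ₂
  have hne0 : (⟨W, hW₂⟩ : hodgeGroupLieRat Φ₂) ≠ 0 := fun h ↦ hW0 (congrArg Subtype.val h)
  obtain ⟨c, hc⟩ := (finrank_eq_one_iff_of_nonzero' (⟨W, hW₂⟩ : hodgeGroupLieRat Φ₂) hne0).1 h1 ⟨B, hB⟩
  have hcB : c • W = B := congrArg Subtype.val hc
  rw [← hcB, show fromBlocks (0 : Matrix ι₁ ι₁ ℚ) 0 0 (c • W) = c • fromBlocks (0 : Matrix ι₁ ι₁ ℚ) 0 0 W by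
    rw [fromBlocks_smul, smul_zero, smul_zero, smul_zero]]
  exact (hodgeGroupLieRat (prodPeriod Φ₁ Φ₂)).smul_mem c hW

/-- **NON-SPLIT WITH `dim_ℚ 𝒜(X₂) = 1 ⟹ r₁ : 𝒜(X₁ × X₂) ≅ 𝒜(X₁)` OVER `ℚ`** — Moonen–Zarhin's «`𝔥𝔤(X) = 𝔤₁ ⊕ 𝔤₃ ≅ 𝔥𝔤(X₁)`»: the
first block projection is onto (g42-#1) and its kernel `≅ 𝔤₂(ℚ)` vanishes. [cite: MoonenZarhin1999LowDim, §3 Lemma (3.6), proof (p0007 L22–L28)]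
[cite: Gordon1997, §2.16 Proposition] -/
theorem nonempty_lieEquiv_hodgeGroupLieRat_prod_of_ne_of_finrank_eq_one (h1 : finrank ℚ (hodgeGroupLieRat Φ₂) = 1)
    (hne : hodgeGroupC (prodPeriod Φ₁ Φ₂) ≠ blockDiagProd (hodgeGroupC Φ₁) (hodgeGroupC Φ₂)) :
    Nonempty (hodgeGroupLieRat (prodPeriod Φ₁ Φ₂) ≃ₗ⁅ℚ⁆ hodgeGroupLieRat Φ₁) := by
  obtain ⟨f, g, hf, -, hfs, -, -⟩ := exists_lieHom_toBlocks_rat Φ₁ Φ₂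
  refine ⟨LieEquiv.ofBijective f ⟨?_, hfs⟩⟩
  rw [← LieHom.ker_eq_bot, eq_bot_iff]
  intro C hC
  rw [LieHom.mem_ker] at hC
  have h₁ : (C : Matrix (ι₁ ⊕ ι₂) (ι₁ ⊕ ι₂) ℚ).toBlocks₁₁ = 0 := by rw [← hf C, hC]; rfl
  have hCeq := eq_fromBlocks_of_mem_hodgeGroupLieRat_prod Φ₁ Φ₂ C.2
  rw [h₁] at hCeq
  have hmem : fromBlocks (0 : Matrix ι₁ ι₁ ℚ) 0 0 (C : Matrix (ι₁ ⊕ ι₂) (ι₁ ⊕ ι₂) ℚ).toBlocks₂₂ ∈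
      hodgeGroupLieRat (prodPeriod Φ₁ Φ₂) := by
    rw [← hCeq]; exact C.2
  have h₂ := eq_zero_of_zero_fromBlocks_mem_of_ne_of_finrank_eq_one Φ₁ Φ₂ h1 hne hmem
  rw [LieSubmodule.mem_bot, ← Subtype.coe_inj, ZeroMemClass.coe_zero, hCeq, h₂, fromBlocks_zero]

/-- … hence `dim_ℚ 𝒜(X₁ × X₂) = dim_ℚ 𝒜(X₁)` (`= dim Hg(X₁)`) in the non-split case with `dim_ℚ 𝒜(X₂) = 1`.
[cite: MoonenZarhin1999LowDim, §3 Lemma (3.6), proof] [cite: Hazama1983, Lemma (3.1)] -/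
theorem finrank_hodgeGroupLieRat_prod_eq_of_ne_of_finrank_eq_one (h1 : finrank ℚ (hodgeGroupLieRat Φ₂) = 1)
    (hne : hodgeGroupC (prodPeriod Φ₁ Φ₂) ≠ blockDiagProd (hodgeGroupC Φ₁) (hodgeGroupC Φ₂)) :
    finrank ℚ (hodgeGroupLieRat (prodPeriod Φ₁ Φ₂)) = finrank ℚ (hodgeGroupLieRat Φ₁) := by
  obtain ⟨e⟩ := nonempty_lieEquiv_hodgeGroupLieRat_prod_of_ne_of_finrank_eq_one Φ₁ Φ₂ h1 hne
  exact e.toLinearEquiv.finrank_eq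

/-- With `dim_ℚ 𝒜(X₂) = 1`: split ⟺ `dim_ℚ 𝒜(X₁ × X₂) = dim_ℚ 𝒜(X₁) + 1`, non-split ⟺ `dim_ℚ 𝒜(X₁ × X₂) = dim_ℚ 𝒜(X₁)`.
[cite: Hazama1983, Lemma (3.1)] [cite: MoonenZarhin1999LowDim, §3 (3.1) and Lemma (3.6)] -/
theorem finrank_hodgeGroupLieRat_prod_eq_iff_ne_of_finrank_eq_one (h1 : finrank ℚ (hodgeGroupLieRat Φ₂) = 1) :
    finrank ℚ (hodgeGroupLieRat (prodPeriod Φ₁ Φ₂)) = finrank ℚ (hodgeGroupLieRat Φ₁) ↔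
      hodgeGroupC (prodPeriod Φ₁ Φ₂) ≠ blockDiagProd (hodgeGroupC Φ₁) (hodgeGroupC Φ₂) := by
  refine ⟨fun h hs ↦ ?_, finrank_hodgeGroupLieRat_prod_eq_of_ne_of_finrank_eq_one Φ₁ Φ₂ h1⟩
  have h' := (finrank_hodgeGroupLieRat_prod_eq_add_iff Φ₁ Φ₂).2 hs
  omega

variable {Φ₁} {η₁ : E₁ [⋀^Fin 2]→L[ℝ] ℝ}

/-- **THE GRAPH (MZ (3.6) ∕ (3.8) infinitesimally, over `ℚ`).**  `X₁` polarised, `dim_ℚ 𝒜(X₂) = 1`, non-split: every NON-ZERO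
`W ∈ 𝒜(X₂)` pairs with a NON-ZERO central Rosati-antisymmetric endomorphism `B ∈ 𝒜(X₁) ∩ Z(End⁰(X₁))` of `X₁`, `(B 0; 0 W) ∈ 𝒜(X₁ × X₂)`,
`(0 0; 0 W) ∉ 𝒜(X₁ × X₂)`, and `B` is unique modulo `𝔤₁(ℚ) = {A | (A 0; 0 0) ∈ 𝒜(X₁ × X₂)}` — the Lie algebra of «an algebraic
torus [in the center of `Hg(X₁)`] `ℚ`-isogenous to `Hg(X₂)`», inside that of `U_{F₁} × ⋯ × U_{F_n}`.
[cite: MoonenZarhin1999LowDim, §3 Lemma (3.6) and Prop. (3.8), proof (p0007 L16–L28, L64–L70)] [cite: Lange2023AbelianVarietiesComplex, §7.2.2 Prop. 7.2.5 and §7.2.1 Prop. 7.2.3] -/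
theorem IsRiemannForm.exists_ne_zero_mem_center_endAlgRat_fromBlocks_mem_of_ne_of_finrank_eq_one (hη₁ : IsRiemannForm Φ₁ η₁)
    (h1 : finrank ℚ (hodgeGroupLieRat Φ₂) = 1)
    (hne : hodgeGroupC (prodPeriod Φ₁ Φ₂) ≠ blockDiagProd (hodgeGroupC Φ₁) (hodgeGroupC Φ₂))
    {W : Matrix ι₂ ι₂ ℚ} (hW : W ∈ hodgeGroupLieRat Φ₂) (hW0 : W ≠ 0) :
    ∃ B ∈ hodgeGroupLieRat Φ₁, B ∈ endAlgRat Φ₁ ∧ B ≠ 0 ∧ (∀ C ∈ endAlgRat Φ₁, B * C = C * B) ∧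
      (∀ G₀ : Matrix ι₁ ι₁ ℚ, G₀.map ((↑) : ℚ → ℝ) = latticeGram Φ₁ η₁ → rosati G₀ B = -B) ∧
      fromBlocks B 0 0 W ∈ hodgeGroupLieRat (prodPeriod Φ₁ Φ₂) ∧
      fromBlocks (0 : Matrix ι₁ ι₁ ℚ) 0 0 W ∉ hodgeGroupLieRat (prodPeriod Φ₁ Φ₂) ∧
      ∀ B' : Matrix ι₁ ι₁ ℚ, fromBlocks B' 0 0 W ∈ hodgeGroupLieRat (prodPeriod Φ₁ Φ₂) →
        fromBlocks (B - B') 0 0 (0 : Matrix ι₂ ι₂ ℚ) ∈ hodgeGroupLieRat (prodPeriod Φ₁ Φ₂) := by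
  letI : LieRing (Matrix (ι₁ ⊕ ι₂) (ι₁ ⊕ ι₂) ℚ) := LieRing.ofAssociativeRing
  letI : LieAlgebra ℚ (Matrix (ι₁ ⊕ ι₂) (ι₁ ⊕ ι₂) ℚ) := LieAlgebra.ofAssociativeAlgebra
  haveI := isLieAbelian_hodgeGroupLieRat_of_finrank_eq_one Φ₂ h1
  obtain ⟨B, hB, hBE, hcomm, hros, hmem⟩ := hη₁.exists_mem_center_endAlgRat_fromBlocks_mem_of_isSolvable Φ₂ hW
  have hnot : fromBlocks (0 : Matrix ι₁ ι₁ ℚ) 0 0 W ∉ hodgeGroupLieRat (prodPeriod Φ₁ Φ₂) :=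
    fun h ↦ hW0 (eq_zero_of_zero_fromBlocks_mem_of_ne_of_finrank_eq_one Φ₁ Φ₂ h1 hne h)
  refine ⟨B, hB, hBE, ?_, hcomm, hros, hmem, hnot, fun B' hB' ↦ ?_⟩
  · rintro rfl
    exact hnot hmem
  · have h := sub_mem hmem hB'
    rwa [fromBlocks_diag_sub_fromBlocks_diag, sub_self] at h

/-- **MOONEN–ZARHIN (3.8) AS A DICHOTOMY, RATIONAL INFINITESIMAL FORM.**  `X₁` polarised, `X₂` with `dim_ℚ 𝒜(X₂) = 1` (a CM
elliptic curve, say): EITHER `Hg(X₁ × X₂)(ℂ) = Hg(X₁)(ℂ) × Hg(X₂)(ℂ)`, OR `𝒜(X₁ × X₂) ≅ 𝒜(X₁)` by the first block projection and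
every non-zero `W ∈ 𝒜(X₂)` is matched, inside `𝒜(X₁ × X₂)`, by a NON-ZERO Rosati-antisymmetric element `B` of `𝒜(X₁)` lying in
the CENTRE OF `End⁰(X₁)` (so `End⁰(X₁)` has a factor «of type IV»: its centre is not fixed by the Rosati involution).
[cite: MoonenZarhin1999LowDim, §3 Prop. (3.8) (p0007 L55–L72)] [cite: Lange2023AbelianVarietiesComplex, §7.2.2 Prop. 7.2.5] -/
theorem IsRiemannForm.hodgeGroupC_prod_eq_blockDiagProd_or_exists_of_finrank_eq_one (hη₁ : IsRiemannForm Φ₁ η₁)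
    (h1 : finrank ℚ (hodgeGroupLieRat Φ₂) = 1) :
    hodgeGroupC (prodPeriod Φ₁ Φ₂) = blockDiagProd (hodgeGroupC Φ₁) (hodgeGroupC Φ₂) ∨
      (Nonempty (hodgeGroupLieRat (prodPeriod Φ₁ Φ₂) ≃ₗ⁅ℚ⁆ hodgeGroupLieRat Φ₁) ∧
        ∀ W ∈ hodgeGroupLieRat Φ₂, W ≠ 0 →
          fromBlocks (0 : Matrix ι₁ ι₁ ℚ) 0 0 W ∉ hodgeGroupLieRat (prodPeriod Φ₁ Φ₂) ∧
          ∃ B ∈ hodgeGroupLieRat Φ₁, B ∈ endAlgRat Φ₁ ∧ B ≠ 0 ∧ (∀ C ∈ endAlgRat Φ₁, B * C = C * B) ∧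
            (∀ G₀ : Matrix ι₁ ι₁ ℚ, G₀.map ((↑) : ℚ → ℝ) = latticeGram Φ₁ η₁ → rosati G₀ B = -B) ∧
            fromBlocks B 0 0 W ∈ hodgeGroupLieRat (prodPeriod Φ₁ Φ₂)) := by
  by_cases hs : hodgeGroupC (prodPeriod Φ₁ Φ₂) = blockDiagProd (hodgeGroupC Φ₁) (hodgeGroupC Φ₂)
  · exact Or.inl hs
  · refine Or.inr ⟨nonempty_lieEquiv_hodgeGroupLieRat_prod_of_ne_of_finrank_eq_one Φ₁ Φ₂ h1 hs, fun W hW hW0 ↦ ?_⟩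
    obtain ⟨B, hB, hBE, hB0, hcomm, hros, hmem, hnot, -⟩ :=
      hη₁.exists_ne_zero_mem_center_endAlgRat_fromBlocks_mem_of_ne_of_finrank_eq_one Φ₂ h1 hs hW hW0
    exact ⟨hnot, B, hB, hBE, hB0, hcomm, hros, hmem⟩

/-- In particular (`dim_ℚ 𝒜(X₂) = 1`, `X₁` polarised with `𝒜(X₁) ∩ End⁰(X₁) = 0`, e.g. `𝒜(X₁)` semisimple): the product SPLITS.
[cite: MoonenZarhin1999LowDim, §3 Prop. (3.8)] -/
theorem IsRiemannForm.hodgeGroupC_prod_eq_blockDiagProd_of_forall_mem_endAlgRat_eq_zero_of_finrank_eq_one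
    (hη₁ : IsRiemannForm Φ₁ η₁) (h1 : finrank ℚ (hodgeGroupLieRat Φ₂) = 1)
    (h0 : ∀ B ∈ hodgeGroupLieRat Φ₁, B ∈ endAlgRat Φ₁ → B = 0) :
    hodgeGroupC (prodPeriod Φ₁ Φ₂) = blockDiagProd (hodgeGroupC Φ₁) (hodgeGroupC Φ₂) := by
  haveI := isLieAbelian_hodgeGroupLieRat_of_finrank_eq_one Φ₂ h1
  exact hη₁.hodgeGroupC_prod_eq_blockDiagProd_of_forall_mem_endAlgRat_eq_zero_of_isSolvable Φ₂ h0

end OneDimensional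

/-! ### §3 The CM elliptic curve `E_τ` as the second factor (`dim_ℚ 𝒜(E_τ) = 1`) -/

section EllipticCurve

variable {ι₁ : Type*} [Fintype ι₁] [DecidableEq ι₁] {E₁ : Type*} [NormedAddCommGroup E₁] [NormedSpace ℂ E₁]
  {Φ₁ : (ι₁ → ℝ) ≃L[ℝ] E₁} {η₁ : E₁ [⋀^Fin 2]→L[ℝ] ℝ} {τ : ℂ} (hτ : τ.im ≠ 0)

/-- **MOONEN–ZARHIN (3.8) FOR `X₁ × E_τ`, `E_τ` AN ELLIPTIC CURVE WITH COMPLEX MULTIPLICATION** (`End(E_τ) ≠ ℤ`, so `𝒜(E_τ)` is the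
trace-zero line of the CM field, `dim_ℚ = 1`): either `Hg(X₁ × E_τ)(ℂ) = Hg(X₁)(ℂ) × Hg(E_τ)(ℂ)`, or `𝒜(X₁ × E_τ) ≅ 𝒜(X₁)` and every
non-zero `W ∈ 𝒜(E_τ)` pairs in `𝒜(X₁ × E_τ)` with a non-zero Rosati-antisymmetric `B ∈ 𝒜(X₁) ∩ Z(End⁰(X₁))`.
[cite: MoonenZarhin1999LowDim, §3 Prop. (3.8) (p0007 L55–L72: "either `Hg(X × E) = Hg(X) × Hg(E)` or `End⁰(E) = k` is an imaginary quadratic field such that there exists an embedding of `k` into the center of `End⁰(X)`")]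
[cite: Lange2023AbelianVarietiesComplex, §7.2.2 Prop. 7.2.5] -/
theorem IsRiemannForm.hodgeGroupC_prod_ellipticPeriod_eq_blockDiagProd_or_exists (hη₁ : IsRiemannForm Φ₁ η₁)
    (hCM : ellipticEnd hτ ≠ ⊥) :
    hodgeGroupC (prodPeriod Φ₁ (ellipticPeriod hτ)) = blockDiagProd (hodgeGroupC Φ₁) (hodgeGroupC (ellipticPeriod hτ)) ∨
      (Nonempty (hodgeGroupLieRat (prodPeriod Φ₁ (ellipticPeriod hτ)) ≃ₗ⁅ℚ⁆ hodgeGroupLieRat Φ₁) ∧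
        ∀ W ∈ hodgeGroupLieRat (ellipticPeriod hτ), W ≠ 0 →
          fromBlocks (0 : Matrix ι₁ ι₁ ℚ) 0 0 W ∉ hodgeGroupLieRat (prodPeriod Φ₁ (ellipticPeriod hτ)) ∧
          ∃ B ∈ hodgeGroupLieRat Φ₁, B ∈ endAlgRat Φ₁ ∧ B ≠ 0 ∧ (∀ C ∈ endAlgRat Φ₁, B * C = C * B) ∧
            (∀ G₀ : Matrix ι₁ ι₁ ℚ, G₀.map ((↑) : ℚ → ℝ) = latticeGram Φ₁ η₁ → rosati G₀ B = -B) ∧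
            fromBlocks B 0 0 W ∈ hodgeGroupLieRat (prodPeriod Φ₁ (ellipticPeriod hτ))) :=
  hη₁.hodgeGroupC_prod_eq_blockDiagProd_or_exists_of_finrank_eq_one (ellipticPeriod hτ)
    (finrank_hodgeGroupLieRat_ellipticPeriod_of_ne_bot hτ hCM)

/-- For `X₁ × E_τ` with `E_τ` CM and `𝒜(X₁) ∩ End⁰(X₁) = 0` (e.g. `End⁰(X₁)` with trivial centre intersection, `𝒜(X₁)` semisimple):
`Hg(X₁ × E_τ) = Hg(X₁) × Hg(E_τ)`. [cite: MoonenZarhin1999LowDim, §3 Prop. (3.8)] -/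
theorem IsRiemannForm.hodgeGroupC_prod_ellipticPeriod_eq_blockDiagProd_of_forall_mem_endAlgRat_eq_zero
    (hη₁ : IsRiemannForm Φ₁ η₁) (hCM : ellipticEnd hτ ≠ ⊥) (h0 : ∀ B ∈ hodgeGroupLieRat Φ₁, B ∈ endAlgRat Φ₁ → B = 0) :
    hodgeGroupC (prodPeriod Φ₁ (ellipticPeriod hτ)) = blockDiagProd (hodgeGroupC Φ₁) (hodgeGroupC (ellipticPeriod hτ)) :=
  hη₁.hodgeGroupC_prod_eq_blockDiagProd_of_forall_mem_endAlgRat_eq_zero_of_finrank_eq_one (ellipticPeriod hτ)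
    (finrank_hodgeGroupLieRat_ellipticPeriod_of_ne_bot hτ hCM) h0

end EllipticCurve

end ComplexTorus

end Literature.Geometry.Kaehler
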